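import Summits.NavierStokesRegularity.NavierStokesRegularity.Theorems.AdaptedFrequencyTangentFlowTransferViscosity
import Summits.NavierStokesRegularity.NavierStokesRegularity.Theorems.AdaptedFrequencyFrequencyRigidityTypeIBoundTimeDilation
import Summits.NavierStokesRegularity.NavierStokesRegularity.Theorems.AdaptedFrequencyFrequencyRigidityFlatBackwardSingular
import Summits.NavierStokesRegularity.NavierStokesRegularity.Theorems.AdaptedFrequencyFrequencyRigidityFrameNormalisation
import Literature.Analysis.FluidPDE.AxisymmetricVorticityTransport
import HarnessLib

/-!
# Crux `FrequencyRigidity` (stmt-NavierStokesRegularity-2955), line `scaled-energy-split`: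
# viscosity normalisation of a finite-scaled-energy witness

Helper file (`--supports stmt-NavierStokesRegularity-2955`; theorems only, sorry-free).  A witness
`(ν, C, Λ₀, v, q, K)` of the crux body with finite Albritton–Barker quantity `𝐈(v, q, Dv) < ⊤` (an
inhabitant of Stub 2 `stub_finiteScaledEnergyLiouville`) is normalised to unit viscosity by the pure time
dilation `u(s, y) = ν⁻¹ v(ν⁻¹ s, y)`, `π(s, y) = ν⁻² q(ν⁻¹ s, y)` (tree: `IsClassicalNSSolutionOn.stRescale`,
`stPull ν⁻¹ 1 0 0`).  The normalised pair is a classical solution with `ν = 1` on `(−∞, 0)`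
(`classical_viscosity`), keeps the time-Type-I bound with constant `C/√ν` (`hasTypeITimeDecay_viscosity`),
keeps `𝐈 < ⊤` (`typeIBound_viscosity_lt_top`, by the landed `stub_typeIBound_timeDilation`), stays
backward-singular at the pole (`isBackwardSingularPoint_viscosity`, by `singular_viscosity`) and stays
axisymmetric (`isAxisymmetric_viscosity`).  These are the inputs of the targets stated at `ν = 1`:
`NoTypeIRateProfile` (stmt-1588) and Seregin–Šverák's axisymmetric Type-I exclusion.

## References

* T. Tao, *Localisation and compactness properties of the Navier–Stokes global regularity problem*,
  Anal. PDE 6 (2013) = arXiv:1108.1165 (2011), footnote 3 (viscosity normalisation). [Tao2011]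
* D. Albritton, T. Barker, J. Math. Fluid Mech. 21 (2019), §1. [AlbrittonBarker2019]
-/

noncomputable section

set_option linter.dupNamespace false

namespace Summit.NavierStokesRegularity.NavierStokesRegularity.Theorems.FrequencyRigidity.ScaledEnergySplit

open Literature.Analysis.FluidPDE MeasureTheory Set Filter Topology Function Metric
open Summit.NavierStokesRegularity.NavierStokesRegularity.Theorems.FrequencyRigidity.Negative (E3)

/-! ## The normalised pair -/

/-- The viscosity-normalised velocity `u(s, y) = ν⁻¹ v(ν⁻¹ s, y)`, unfolded. [folklore] -/
theorem visc_velocity_eq (ν : ℝ) (v : ℝ → E3 → E3) :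
    (ν⁻¹ • stPull ν⁻¹ 1 0 0 v) = fun t x => ν⁻¹ • v (ν⁻¹ * t) x := by
  funext t x
  simp [stPull_apply]

/-- The viscosity-normalised pressure `π(s, y) = ν⁻² q(ν⁻¹ s, y)`, unfolded. [folklore] -/
theorem visc_pressure_eq (ν : ℝ) (q : ℝ → E3 → ℝ) :
    ((ν⁻¹) ^ 2 • stPull ν⁻¹ 1 0 0 q) = fun t x => (ν⁻¹) ^ 2 * q (ν⁻¹ * t) x := by
  funext t x
  simp [stPull_apply]

/-- The dilation `s ↦ ν⁻¹ s` pulls `(−∞, 0)` back to itself (`ν > 0`). [folklore] -/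
theorem preimage_viscTime_Iio {ν : ℝ} (hν : 0 < ν) :
    (fun r : ℝ => 0 + ν⁻¹ * r) ⁻¹' Iio (0:ℝ) = Iio 0 := by
  ext r
  simp only [mem_preimage, mem_Iio, zero_add]
  constructor
  · intro h
    by_contra hr
    rw [not_lt] at hr
    exact (mul_nonneg (inv_pos.2 hν).le hr).not_gt h
  · intro h
    exact mul_neg_of_pos_of_neg (inv_pos.2 hν) h

/-- **The normalised pair is a classical solution with unit viscosity on `(−∞, 0)`.** [cite: Tao2011, footnote 3] -/
theorem classical_viscosity {ν : ℝ} {v : ℝ → E3 → E3} {q : ℝ → E3 → ℝ} (hν : 0 < ν)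
    (h : IsClassicalNSSolutionOn (Iio 0) ν 0 v q) :
    IsClassicalNSSolutionOn (Iio 0) 1 0 (ν⁻¹ • stPull ν⁻¹ 1 0 0 v) ((ν⁻¹) ^ 2 • stPull ν⁻¹ 1 0 0 q) := by
  have key := h.stRescale (inv_pos.2 hν) one_pos (by rw [mul_one]) 0 (0 : E3)
  rw [smul_stPull_zero, preimage_viscTime_Iio hν,
    show ν⁻¹ * ν / 1 = (1 : ℝ) by rw [div_one, inv_mul_cancel₀ hν.ne']] at key
  exact key

/-- **The Type-I bound survives with constant `C/√ν`.** [folklore] -/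
theorem hasTypeITimeDecay_viscosity {ν C : ℝ} {v : ℝ → E3 → E3} (hν : 0 < ν)
    (h : ∀ t ∈ Iio (0:ℝ), ∀ x, ‖v t x‖ ≤ C / Real.sqrt (-t)) :
    HasTypeITimeDecay (C / Real.sqrt ν) (ν⁻¹ • stPull ν⁻¹ 1 0 0 v) := by
  intro s hs y
  have h' : ∀ t ∈ Ioo (ν⁻¹ * s - 1) 0, ∀ x, ‖v t x‖ ≤ C / Real.sqrt (0 - t) := fun t ht x => by
    rw [zero_sub]; exact h t ht.2 x
  have hb := typeI_bound_viscosity (u := v) h' hν s ⟨by nlinarith [mul_inv_cancel₀ hν.ne'], by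
    rw [mul_zero]; exact hs⟩ y
  rwa [mul_zero, zero_sub] at hb

/-- The gradient of the normalised velocity is `ν⁻¹ Dv(ν⁻¹ s, ·)` (any constant is allowed over a
field, `fderiv_const_smul_field`). [folklore] -/
theorem fderiv_visc_velocity (ν : ℝ) (v : ℝ → E3 → E3) :
    (fun t x => fderiv ℝ ((fun t x => ν⁻¹ • v (ν⁻¹ * t) x) t) x) =
      fun t x => ν⁻¹ • fderiv ℝ (v (ν⁻¹ * t)) x := by
  funext t x
  show fderiv ℝ (ν⁻¹ • v (ν⁻¹ * t)) x = _
  rw [fderiv_const_smul_field]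
  rfl

/-- **`𝐈 < ⊤` survives** (landed `stub_typeIBound_timeDilation` with `β = a = ν⁻¹`, `b = ν⁻²`).
[cite: AlbrittonBarker2019, §1] -/
theorem typeIBound_viscosity_lt_top {ν : ℝ} {v : ℝ → E3 → E3} {q : ℝ → E3 → ℝ} (hν : 0 < ν)
    (hI : typeIBound (Iio (0:ℝ) ×ˢ univ) v q (fun t x => fderiv ℝ (v t) x) < ⊤) :
    typeIBound (Iio (0:ℝ) ×ˢ univ) (ν⁻¹ • stPull ν⁻¹ 1 0 0 v) ((ν⁻¹) ^ 2 • stPull ν⁻¹ 1 0 0 q)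
      (fun t x => fderiv ℝ ((ν⁻¹ • stPull ν⁻¹ 1 0 0 v) t) x) < ⊤ := by
  have key := stub_typeIBound_timeDilation ν⁻¹ ν⁻¹ ((ν⁻¹) ^ 2) v q (fun t x => fderiv ℝ (v t) x)
    (inv_pos.2 hν) hI
  rw [visc_velocity_eq, visc_pressure_eq, fderiv_visc_velocity]
  exact key

/-- **Backward singularity of the pole survives** (`singular_viscosity` at the pole `(0, 0)`). [cite: AlbrittonBarker2019, §1] -/
theorem isBackwardSingularPoint_viscosity {ν : ℝ} {v : ℝ → E3 → E3} (hν : 0 < ν)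
    (h : IsBackwardSingularPoint v 0) : IsBackwardSingularPoint (ν⁻¹ • stPull ν⁻¹ 1 0 0 v) 0 := by
  have h' : ∀ r : ℝ, 0 < r → eLpNorm (uncurry v) ⊤
      (volume.restrict (parabolicCylinder r (((0:ℝ), (0:E3)) : ℝ × E3))) = ⊤ := h
  have key := singular_viscosity (u := v) h' hν
  rw [mul_zero] at key
  exact key

/-- **Axisymmetry survives** (the normalisation is an amplitude rescaling of time slices). [folklore] -/
theorem isAxisymmetric_viscosity {ν : ℝ} {v : ℝ → E3 → E3}
    (h : ∀ t ∈ Iio (0:ℝ), IsAxisymmetric (v t)) (hν : 0 < ν) :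
    ∀ t ∈ Iio (0:ℝ), IsAxisymmetric ((ν⁻¹ • stPull ν⁻¹ 1 0 0 v) t) := by
  intro t ht θ x
  have ht' : ν⁻¹ * t ∈ Iio (0:ℝ) := mul_neg_of_pos_of_neg (inv_pos.2 hν) ht
  simp only [Pi.smul_apply, stPull_apply, zero_add, one_smul]
  rw [h _ ht' θ x, ← rotZL_apply θ (ν⁻¹ • v (ν⁻¹ * t) x), map_smul, rotZL_apply]

/-! ## Registered sub-goal -/

/-- **Registered sub-goal `stub_viscosityNormalisation` of Stub 2 (line `scaled-energy-split`)**: the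
viscosity normalisation of a finite-scaled-energy witness, packaged (unit viscosity, Type-I constant `C/√ν`,
`𝐈 < ⊤`, backward-singular pole, axisymmetry preserved). [cite: Tao2011, footnote 3] -/
theorem stub_viscosityNormalisation : ∀ (ν C : ℝ) (v : ℝ → EuclideanSpace ℝ (Fin 3) → EuclideanSpace ℝ (Fin 3)) (q : ℝ → EuclideanSpace ℝ (Fin 3) → ℝ), 0 < ν → Literature.Analysis.FluidPDE.IsClassicalNSSolutionOn (Set.Iio 0) ν 0 v q → (∀ t ∈ Set.Iio (0:ℝ), ∀ x, ‖v t x‖ ≤ C / Real.sqrt (-t)) → Literature.Analysis.FluidPDE.typeIBound (Set.Iio (0:ℝ) ×ˢ Set.univ) v q (fun t x => fderiv ℝ (v t) x) < ⊤ → Literature.Analysis.FluidPDE.IsBackwardSingularPoint v 0 → ∃ (u : ℝ → EuclideanSpace ℝ (Fin 3) → EuclideanSpace ℝ (Fin 3)) (π : ℝ → EuclideanSpace ℝ (Fin 3) → ℝ), Literature.Analysis.FluidPDE.IsClassicalNSSolutionOn (Set.Iio 0) 1 0 u π ∧ Literature.Analysis.FluidPDE.HasTypeITimeDecay (C / Real.sqrt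 ν) u ∧ Literature.Analysis.FluidPDE.typeIBound (Set.Iio (0:ℝ) ×ˢ Set.univ) u π (fun t x => fderiv ℝ (u t) x) < ⊤ ∧ Literature.Analysis.FluidPDE.IsBackwardSingularPoint u 0 ∧ ((∀ t ∈ Set.Iio (0:ℝ), Literature.Analysis.FluidPDE.IsAxisymmetric (v t)) → ∀ t ∈ Set.Iio (0:ℝ), Literature.Analysis.FluidPDE.IsAxisymmetric (u t)) :=
  fun ν _ v q hν hNS hTI hI hsing =>
    ⟨ν⁻¹ • stPull ν⁻¹ 1 0 0 v, (ν⁻¹) ^ 2 • stPull ν⁻¹ 1 0 0 q, classical_viscosity hν hNS,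
      hasTypeITimeDecay_viscosity hν hTI, typeIBound_viscosity_lt_top hν hI,
      isBackwardSingularPoint_viscosity hν hsing, fun hax => isAxisymmetric_viscosity hax hν⟩

end Summit.NavierStokesRegularity.NavierStokesRegularity.Theorems.FrequencyRigidity.ScaledEnergySplit

end
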